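import Summits.CriticalPhenomena.PercolationContinuityZ3.Theorems.PercNearOneGluingNoHeavyLowerTailKnQuestion8CoefficientwiseOffClusterTwo
import Summits.CriticalPhenomena.PercolationContinuityZ3.Theorems.PercNearOneGluingNoHeavyLowerTailKnQuestion8CoefficientwiseGluing
import HarnessLib

/-!
# The two-function off-cluster lemma with a GENERAL monotone complement side — prim-lf-2 gen 55

Support file (`--supports stmt-CriticalPhenomena-4575`, closed), prover `prim-lf-2` (gen 55).  No definitions, no named facts, no sorries; standard axioms.
Memo `prim-lf-2/CW-TWOSOURCESYM-gen55.md` §3.6 (ingredient (a) of the TAME parallel composition theorem for the NO-CORE class).  Template: gen 26's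
`…CoefficientwiseOffClusterTwo.lean` (`offCluster_twoColouring_nonneg₂`), whose proof never uses that the complement-side functions are functions of the blue cluster of `x`.

* `Coefficientwise.offCluster_twoColouring_nonneg_gen` — for a vertex set `A`, monotone `f, g : Set V → ℝ` and ANY monotone `F', G' : Finset ι → ℝ` with `f(C_x t) ≤ F' t`, `g(C_x t) ≤ G' t`
  for all `t`:  `0 ≤ Σ_{s : A ∩ C_x(s) = ∅} (f(C_x s) − F'(sᶜ))·(g(C_x s) − G'(sᶜ))`.  (Cells of the red cluster of `A`: on a cell `C_x` lives in the free coordinates and is dominated by its own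
  free flip, `twoColouring_cell_nonneg_of_le₂`.)  Typical use: `F' t = f(C_x t ∪ C_y t ∪ W)` — the blue side may be the blue cluster of a SET plus a constant.
* `Coefficientwise.offCluster_twoColouring_nonneg_gen_sub` — the same on the colourings `E'.powerset` of an edge set `E' ⊆ ι` (complement `E' ∖ t`).
[cite: KozmaNitzan2024, Questions 8–9 (§5.5 p. 36) (context: the Question-8 pocket covariance programme)]
-/

namespace Summit.CriticalPhenomena.PercolationContinuityZ3.Theorems

open Finset Literature.Probability.Percolation

namespace Coefficientwise

variable {ι V : Type*} [Fintype ι] [DecidableEq ι]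

open Classical in
/-- **Two-function off-cluster lemma, general complement side.**  For a vertex set `A`, monotone `f, g` and any monotone `F', G' : Finset ι → ℝ` dominating `t ↦ f(C_x t)`, `t ↦ g(C_x t)`
pointwise: `0 ≤ Σ_{s : A ∩ C_x(s) = ∅} (f(C_x s) − F'(sᶜ))(g(C_x s) − G'(sᶜ))`.  [cite: KozmaNitzan2024, Questions 8–9 (§5.5 p. 36) (context)] -/
theorem offCluster_twoColouring_nonneg_gen (ends : ι → Sym2 V) (x : V) (A : Set V) (f g : Set V → ℝ) (F' G' : Finset ι → ℝ)
    (hf : Monotone f) (hg : Monotone g) (hF'm : Monotone F') (hG'm : Monotone G')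
    (hfF' : ∀ t : Finset ι, f (openCluster (ends '' (↑t : Set ι)) x) ≤ F' t)
    (hgG' : ∀ t : Finset ι, g (openCluster (ends '' (↑t : Set ι)) x) ≤ G' t) :
    0 ≤ ∑ s ∈ univ.filter (fun s : Finset ι => ∀ a ∈ A, a ∉ openCluster (ends '' (↑s : Set ι)) x),
      (f (openCluster (ends '' (↑s : Set ι)) x) - F' sᶜ) *
        (g (openCluster (ends '' (↑s : Set ι)) x) - G' sᶜ) := by
  -- notation
  set K : Finset ι → Set V := fun s => openCluster (ends '' (↑s : Set ι)) x with hK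
  set F : Finset ι → ℝ := fun s => f (K s) with hF
  set G : Finset ι → ℝ := fun s => g (K s) with hG
  set D : Finset (Finset ι) := univ.filter (fun s : Finset ι => ∀ a ∈ A, a ∉ openCluster (ends '' (↑s : Set ι)) x) with hD
  change 0 ≤ ∑ s ∈ D, (F s - F' sᶜ) * (G s - G' sᶜ)
  have hKmono : ∀ {s t : Finset ι}, s ⊆ t → K s ⊆ K t := fun hst => openCluster_image_mono ends hst x
  have hFm : Monotone F := fun s t hst => hf (hKmono hst)
  have hGm : Monotone G := fun s t hst => hg (hKmono hst)
  -- the red cluster of the set `A`, the edges at a vertex set, and the cell key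
  set R : Finset ι → Set V := fun s => {y | ∃ a ∈ A, y ∈ openCluster (ends '' (↑s : Set ι)) a} with hR
  set I : Set V → Finset ι := fun S => univ.filter (fun i : ι => ∃ v ∈ S, v ∈ ends i) with hI
  set key : Finset ι → Set V × Finset ι := fun s => (R s, s ∩ I (R s)) with hkey
  -- basic facts about `R`
  have R_closed : ∀ (s : Finset ι) {u w : V}, u ∈ R s → (openGraph (ends '' (↑s : Set ι))).Adj u w → w ∈ R s := by
    intro s u w hu hadj
    obtain ⟨a, haA, hau⟩ := hu
    exact ⟨a, haA, SimpleGraph.Reachable.trans hau hadj.reachable⟩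
  have mem_I : ∀ (S : Set V) (i : ι) (v : V), v ∈ S → v ∈ ends i → i ∈ I S := by
    intro S i v hv hvi
    simp only [hI, Finset.mem_filter, Finset.mem_univ, true_and]
    exact ⟨v, hv, hvi⟩
  have A_sub_R : ∀ (s : Finset ι), ∀ a ∈ A, a ∈ R s := fun s a ha => ⟨a, ha, mem_openCluster_self _ a⟩
  -- (L3) locality: a configuration agreeing with `s₀` on the edges at `R s₀` has the same red cluster of `A`
  have locality : ∀ s₀ t : Finset ι, t ∩ I (R s₀) = s₀ ∩ I (R s₀) → R t = R s₀ := by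
    intro s₀ t ht
    have agree : ∀ i, i ∈ I (R s₀) → (i ∈ t ↔ i ∈ s₀) := by
      intro i hi
      have := congrArg (fun u : Finset ι => i ∈ u) ht
      simp only [Finset.mem_inter, hi, and_true, eq_iff_iff] at this
      exact this
    -- transfer s₀-walks to t-walks inside `R s₀`
    have h1 : ∀ u ∈ R s₀, ∀ w, (openGraph (ends '' (↑s₀ : Set ι))).Adj u w →
        (openGraph (ends '' (↑t : Set ι))).Adj u w ∧ w ∈ R s₀ := by
      intro u hu w hadj
      refine ⟨?_, R_closed s₀ hu hadj⟩
      rw [openGraph_image_adj] at hadj ⊢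
      obtain ⟨⟨i, his, hi⟩, hne⟩ := hadj
      have hiI : i ∈ I (R s₀) := mem_I _ i u hu (by rw [hi]; exact Sym2.mem_mk_left u w)
      exact ⟨⟨i, (agree i hiI).mpr his, hi⟩, hne⟩
    -- transfer t-walks to s₀-walks inside `R s₀`
    have h2 : ∀ u ∈ R s₀, ∀ w, (openGraph (ends '' (↑t : Set ι))).Adj u w →
        (openGraph (ends '' (↑s₀ : Set ι))).Adj u w ∧ w ∈ R s₀ := by
      intro u hu w hadj
      have hadj' : (openGraph (ends '' (↑s₀ : Set ι))).Adj u w := by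
        rw [openGraph_image_adj] at hadj ⊢
        obtain ⟨⟨i, hit, hi⟩, hne⟩ := hadj
        have hiI : i ∈ I (R s₀) := mem_I _ i u hu (by rw [hi]; exact Sym2.mem_mk_left u w)
        exact ⟨⟨i, (agree i hiI).mp hit, hi⟩, hne⟩
      exact ⟨hadj', R_closed s₀ hu hadj'⟩
    ext y
    constructor
    · rintro ⟨a, haA, hay⟩
      obtain ⟨p⟩ := hay
      exact ((reachable_transfer (R s₀) h2 p) (A_sub_R s₀ a haA)).2
    · rintro ⟨a, haA, hay⟩
      obtain ⟨p⟩ := hay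
      exact ⟨a, haA, ((reachable_transfer (R s₀) h1 p) (A_sub_R s₀ a haA)).1⟩
  -- split the sum over `D` along the fibres of `key`
  rw [← Finset.sum_fiberwise_of_maps_to (s := D) (t := D.image key) (g := key)
    (fun s hs => Finset.mem_image_of_mem key hs)]
  refine Finset.sum_nonneg fun k hk => ?_
  obtain ⟨s₀, hs₀D, rfl⟩ := Finset.mem_image.mp hk
  have hs₀ : ∀ a ∈ A, a ∉ K s₀ := by
    have := (Finset.mem_filter.mp hs₀D).2
    simpa [hK] using this
  -- abbreviations for the frozen data of the cell of `s₀`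
  set S₀ : Set V := R s₀ with hS₀
  set B : Finset ι := I S₀ with hB
  set π : Finset ι := s₀ ∩ B with hπ
  have hxS₀ : x ∉ S₀ := by
    rintro ⟨a, haA, hax⟩
    exact hs₀ a haA (SimpleGraph.Reachable.symm hax)
  -- (L4) the fibre of `key s₀` in `D` is exactly the cell `{t | t ∩ B = π}`
  have fiber_eq : D.filter (fun t => key t = key s₀) = univ.filter (fun t : Finset ι => t ∩ B = π) := by
    ext t
    simp only [Finset.mem_filter, Finset.mem_univ, true_and]
    constructor
    · rintro ⟨_, hkt⟩
      have h1 : R t = S₀ := (Prod.ext_iff.mp hkt).1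
      have h2 : t ∩ I (R t) = s₀ ∩ I (R s₀) := (Prod.ext_iff.mp hkt).2
      rw [h1] at h2
      exact h2
    · intro ht
      have hRt : R t = S₀ := locality s₀ t ht
      refine ⟨?_, ?_⟩
      · rw [hD, Finset.mem_filter]
        refine ⟨Finset.mem_univ _, fun a haA hax => ?_⟩
        have hxRt : x ∈ R t := ⟨a, haA, SimpleGraph.Reachable.symm hax⟩
        rw [hRt] at hxRt
        exact hxS₀ hxRt
      · change (R t, t ∩ I (R t)) = (R s₀, s₀ ∩ I (R s₀))
        rw [hRt]
        exact Prod.ext rfl ht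
  rw [fiber_eq]
  -- (L5) on the cell, the red cluster of `x` uses no edge at `S₀`
  have offcluster : ∀ t : Finset ι, t ∩ B = π → K t ⊆ K ((B \ π) ∪ (t \ B)) := by
    intro t ht
    have agree : ∀ i, i ∈ B → (i ∈ t ↔ i ∈ s₀) := by
      intro i hi
      have := congrArg (fun u : Finset ι => i ∈ u) ht
      simp only [hπ, Finset.mem_inter, hi, and_true, eq_iff_iff] at this
      exact this
    have htr : ∀ u ∈ S₀ᶜ, ∀ w, (openGraph (ends '' (↑t : Set ι))).Adj u w →
        (openGraph (ends '' (↑(t \ B) : Set ι))).Adj u w ∧ w ∈ S₀ᶜ := by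
      intro u hu w hadj
      rw [openGraph_image_adj] at hadj
      obtain ⟨⟨i, hit, hi⟩, hne⟩ := hadj
      -- the edge `i` is not at `S₀`
      have hiB : i ∉ B := by
        intro hiB
        have his₀ : i ∈ s₀ := (agree i hiB).mp hit
        have hiB' := hiB
        simp only [hB, hI, Finset.mem_filter, Finset.mem_univ, true_and] at hiB'
        obtain ⟨v, hvS, hvi⟩ := hiB'
        rw [hi, Sym2.mem_iff] at hvi
        rcases hvi with rfl | rfl
        · exact hu hvS
        · -- `w ∈ S₀` and the red edge `i ∈ s₀` joins `w` to `u`, so `u ∈ S₀`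
          have hadj₀ : (openGraph (ends '' (↑s₀ : Set ι))).Adj v u := by
            rw [openGraph_image_adj]
            exact ⟨⟨i, his₀, by rw [hi, Sym2.eq_swap]⟩, hne.symm⟩
          exact hu (R_closed s₀ hvS hadj₀)
      have hwS : w ∈ S₀ᶜ := by
        intro hwS
        exact hiB (mem_I S₀ i w hwS (by rw [hi]; exact Sym2.mem_mk_right u w))
      refine ⟨?_, hwS⟩
      rw [openGraph_image_adj]
      exact ⟨⟨i, Finset.mem_sdiff.mpr ⟨hit, hiB⟩, hi⟩, hne⟩
    intro y hy
    obtain ⟨p⟩ := hy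
    have hreach := ((reachable_transfer S₀ᶜ htr p) hxS₀).1
    exact hKmono Finset.subset_union_right hreach
  refine twoColouring_cell_nonneg_of_le₂ B π Finset.inter_subset_right F F' G G' hFm hF'm hGm hG'm (fun t => hfF' t) (fun t => hgG' t) ?_ ?_
  · intro t ht; exact hf (offcluster t ht)
  · intro t ht; exact hg (offcluster t ht)



section sub

omit [Fintype ι] [DecidableEq ι] in
open Classical in
/-- Clusters of a colouring of the sub-multigraph on `{i // i ∈ E'}` are the clusters of its image colouring. [cite: KozmaNitzan2024, §5.5 (context only; bookkeeping)] -/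
private theorem image_map_subtype' (ends : ι → Sym2 V) (E' : Finset ι) (t : Finset {i // i ∈ E'}) :
    (ends ∘ Subtype.val : {i // i ∈ E'} → Sym2 V) '' (↑t : Set {i // i ∈ E'}) =
      ends '' (↑(t.map (Function.Embedding.subtype _)) : Set ι) := by
  ext p
  simp only [Set.mem_image, Finset.mem_coe, Finset.mem_map, Function.Embedding.coe_subtype, Function.comp_apply]
  constructor
  · rintro ⟨j, hj, rfl⟩; exact ⟨j.1, ⟨j, hj, rfl⟩, rfl⟩
  · rintro ⟨i, ⟨j, hj, rfl⟩, rfl⟩; exact ⟨j, hj, rfl⟩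

omit [Fintype ι] in
open Classical in
/-- **Powerset form** of `offCluster_twoColouring_nonneg_gen`: for an edge set `E' ⊆ ι`,
`0 ≤ Σ_{t ⊆ E' : A ∩ C_x(t) = ∅} (f(C_x t) − F'(E' ∖ t))(g(C_x t) − G'(E' ∖ t))` whenever `F', G'` are monotone and dominate `t ↦ f(C_x t)`, `t ↦ g(C_x t)` on the subsets of `E'`.
[cite: KozmaNitzan2024, Questions 8–9 (§5.5 p. 36) (context)] -/
theorem offCluster_twoColouring_nonneg_gen_sub (ends : ι → Sym2 V) (E' : Finset ι) (x : V) (A : Set V) (f g : Set V → ℝ) (F' G' : Finset ι → ℝ)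
    (hf : Monotone f) (hg : Monotone g) (hF'm : Monotone F') (hG'm : Monotone G')
    (hfF' : ∀ t : Finset ι, t ⊆ E' → f (openCluster (ends '' (↑t : Set ι)) x) ≤ F' t)
    (hgG' : ∀ t : Finset ι, t ⊆ E' → g (openCluster (ends '' (↑t : Set ι)) x) ≤ G' t) :
    0 ≤ ∑ t ∈ E'.powerset.filter (fun t : Finset ι => ∀ a ∈ A, a ∉ openCluster (ends '' (↑t : Set ι)) x),
      (f (openCluster (ends '' (↑t : Set ι)) x) - F' (E' \ t)) *
        (g (openCluster (ends '' (↑t : Set ι)) x) - G' (E' \ t)) := by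
  set emb : {i // i ∈ E'} ↪ ι := Function.Embedding.subtype _ with hemb
  have map_sub : ∀ t : Finset {i // i ∈ E'}, t.map emb ⊆ E' := by
    intro t i hi
    obtain ⟨⟨j, hj⟩, _, rfl⟩ := Finset.mem_map.mp hi
    exact hj
  have map_mono : Monotone (fun t : Finset {i // i ∈ E'} => t.map emb) := fun s t hst => Finset.map_subset_map.mpr hst
  have key := offCluster_twoColouring_nonneg_gen (ends ∘ Subtype.val : {i // i ∈ E'} → Sym2 V) x A f g
    (fun t => F' (t.map emb)) (fun t => G' (t.map emb)) hf hg
    (fun s t hst => hF'm (map_mono hst)) (fun s t hst => hG'm (map_mono hst))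
    (fun t => by rw [image_map_subtype' ends E' t]; exact hfF' _ (map_sub t))
    (fun t => by rw [image_map_subtype' ends E' t]; exact hgG' _ (map_sub t))
  have map_compl : ∀ t : Finset {i // i ∈ E'}, (tᶜ).map emb = E' \ t.map emb := by
    intro t
    ext i
    simp only [Finset.mem_map, Finset.mem_compl, Finset.mem_sdiff, hemb, Function.Embedding.coe_subtype]
    constructor
    · rintro ⟨⟨j, hj⟩, hjt, rfl⟩
      exact ⟨hj, fun ⟨⟨k, hk⟩, hkt, hkj⟩ => hjt (by cases hkj; exact hkt)⟩
    · rintro ⟨hiE, hnot⟩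
      exact ⟨⟨i, hiE⟩, fun hit => hnot ⟨⟨i, hiE⟩, hit, rfl⟩, rfl⟩
  refine key.trans_eq ?_
  refine Finset.sum_bij' (fun t _ => t.map emb) (fun t _ => t.subtype (· ∈ E')) ?_ ?_ ?_ ?_ ?_
  · intro t ht
    rw [Finset.mem_filter] at ht ⊢
    refine ⟨Finset.mem_powerset.mpr (map_sub t), ?_⟩
    rw [← image_map_subtype' ends E' t]; exact ht.2
  · intro t ht
    rw [Finset.mem_filter] at ht ⊢
    refine ⟨Finset.mem_univ _, ?_⟩
    have hsub : t ⊆ E' := Finset.mem_powerset.mp ht.1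
    rw [image_map_subtype' ends E', Finset.subtype_map_of_mem (fun i hi => hsub hi)]
    exact ht.2
  · intro t _
    ext ⟨i, hi⟩
    rw [Finset.mem_subtype, Finset.mem_map]
    constructor
    · rintro ⟨⟨j, hj⟩, hjt, hji⟩
      have hji' : j = i := by simpa [hemb] using hji
      subst hji'
      exact hjt
    · intro h
      exact ⟨⟨i, hi⟩, h, by simp [hemb]⟩
  · intro t ht
    have hsub : t ⊆ E' := Finset.mem_powerset.mp (Finset.mem_filter.mp ht).1
    exact Finset.subtype_map_of_mem (fun i hi => hsub hi)
  · intro t _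
    rw [image_map_subtype' ends E' t, map_compl]

end sub

end Coefficientwise

end Summit.CriticalPhenomena.PercolationContinuityZ3.Theorems
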